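import Summits.RiemannHypothesis.RiemannHypothesis.Theorems.HandoffPrimeShadow
import Summits.RiemannHypothesis.RiemannHypothesis.Theorems.HandoffChebyshevMellin
import Summits.RiemannHypothesis.RiemannHypothesis.Theorems.HandoffFlatLobe
import HarnessLib

/-!
# HANDOFF — the arithmetic shadow of a window made EXPLICIT: flat lobes of radius `r`, the `2r·log(1/r)` allowance, a
# Brun–Titchmarsh-type bound and the Cramér bound for every gap below the window (rh-explicit, TRACK «HANDOFF», seat prove-2 gen4, ATTEMPT-11 §3)

HONEST FRAMING. Nothing here bears on RH. Continuation of `HandoffPrimeShadow.lean` (the two-sided shadow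
`|S_ψ(L) − M_ψ(L)| ≤ Re Q(ψ) + 8rM(L/2 − r)‖ψ‖₂²` from `WeilPositivityOn (L/2 + r)` alone) with the bump SPECIALISED to this seat's
flat lobes `flatLobe k r 0` (gen3, `HandoffFlatProfile`/`HandoffFlatLobe`: `= 1` on `|x| ≤ r(1 − 1/(k+2))`, supported in `|x| ≤ r`,
energy ceiling `Re Q ≤ (log(1/r) + C_k)·‖·‖₂²`, `‖·‖₂² = r·N_k ≤ 2r`). Everything is an RH-consequence proved from the window.

* `abs_chebyshev_sub_main_le_flat` — for `0 < r ≤ 1/4`, `2r < L`, `WeilPositivityOn (L/2 + r)`: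
  `|S_r(L) − M_r(L)| ≤ (log(1/r) + C_k + 8r·M(L/2 − r))·r·N_k` (`≤ 2r·(log(1/r) + C_k + 3)` once `L ≥ 2r + 1/2`,
  `abs_chebyshev_sub_main_le_flat'`). With `x = e^{L}` and `h ≍ r·x` this is the RH-quality allowance `≍ √x·(h/x)·log(x/h)` for the
  `φ_r`-smoothed prime count in `[x e^{−2r}, x e^{2r}]`, against a main term `≍ h` — informative exactly when `h ≳ √x log x`.
* `sum_vonMangoldt_window_le` — an UNWEIGHTED corollary (`k = 0`): for any finite set `T` of integers with `|log n − L| ≤ r/2`,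
  `Σ_{n∈T} Λ(n)/√n ≤ 8r e^{r}(e^{L/2} + e^{−L/2}) + 4(log(1/r) + C₀ + 3)` (crude unweighting: constant `8` where the weighted
  statement has `1`; labelled so in ATTEMPT-11).
* `mul_exp_le_of_primePowerFree` — the LOWER half read on a prime-power-free stretch: if no prime power `n` has `|log n − L| ≤ 2r`
  then `r·e^{L/2}·e^{−r}·r·M_k²… ≤` the allowance, i.e. `r√x ≤ 2e^{r}(log(1/r) + C_k + 3)/M_k²`: every multiplicative gap
  `[x e^{−2r}, x e^{2r}]` free of prime powers below the window has `4rx ≲ (8/M_k²)√x·log(1/r)` — Cramér's bound with the constant of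
  this seat's `edgeNonnegOdd_sharp_classification` (gen3), now for EVERY gap below `e^{2a}`, by one mechanism.

References: Montgomery–Vaughan (2007) §13.1, Thm 13.3 (Cramér) and its proof (13.11)–(13.13) — the triangular-weight smoothed Chebyshev sum
under RH, the printed twin of these bounds (`MontgomeryVaughan2007`); Bombieri (2000) §3, Thm 2 (`Bombieri2000Weil`).
NO new definitions (the scaled flat bump is produced inside proofs by `exists_bump_eq_flatLobe`).
-/

set_option linter.dupNamespace false  -- the mandated namespace repeats `RiemannHypothesis`

noncomputable section

open Set Filter Complex MeasureTheory Metric Literature.NumberTheory.LFunctions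
open Summit.RiemannHypothesis.RiemannHypothesis.Theorems.Handoff
open Summit.RiemannHypothesis.RiemannHypothesis.Theorems.HandoffCapSharp
open Summit.RiemannHypothesis.RiemannHypothesis.Theorems.HandoffBumpAutocorr
open Summit.RiemannHypothesis.RiemannHypothesis.Theorems.HandoffDipoleChebyshev
open Summit.RiemannHypothesis.RiemannHypothesis.Theorems.HandoffChebyshevMellin
open Summit.RiemannHypothesis.RiemannHypothesis.Theorems.HandoffPrimeShadow
open scoped Real ComplexConjugate ArithmeticFunction.vonMangoldt

namespace Summit.RiemannHypothesis.RiemannHypothesis.Theorems.HandoffPrimeShadow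

variable {k : ℕ} {r L : ℝ}

/-! ## §1 The flat lobe of radius `r` IS a bump (of inner radius `r(1 − 1/(k+2))`, outer radius `r`) -/

/-- The scaled flat bump: a `ContDiffBump` at `0` with `rOut = r`, `rIn = r·(1 − 1/(k+2))`, whose complexification is
`flatLobe k r 0` (dilation of `flatBump k`; the base bump function is applied to the same normalised argument). [folklore] -/
theorem exists_bump_eq_flatLobe (k : ℕ) (hr : 0 < r) :
    ∃ ψ : ContDiffBump (0 : ℝ), ψ.rOut = r ∧ ψ.rIn = r * (flatBump k).rIn ∧
      (fun x : ℝ ↦ ((ψ x : ℝ) : ℂ)) = flatLobe k r 0 := by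
  have hlt : r * (flatBump k).rIn < r := by
    have := (flatBump k).rIn_lt_rOut
    rw [flatBump_rOut] at this
    nlinarith
  refine ⟨⟨r * (flatBump k).rIn, r, mul_pos hr (flatBump k).rIn_pos, hlt⟩, rfl, rfl, ?_⟩
  funext x
  have happ : (⟨r * (flatBump k).rIn, r, mul_pos hr (flatBump k).rIn_pos, hlt⟩ : ContDiffBump (0 : ℝ)) x =
      (flatBump k) (x / r) := by
    show (someContDiffBumpBase ℝ).toFun _ _ = (someContDiffBumpBase ℝ).toFun _ _
    have hr0 : r ≠ 0 := hr.ne'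
    have hin : (flatBump k).rIn ≠ 0 := (flatBump k).rIn_pos.ne'
    congr 1
    · simp only [flatBump_rOut]
      field_simp
    · simp only [smul_eq_mul, sub_zero]
      field_simp
  simp only [happ, flatLobe, flatProfile, sub_zero]

/-- For such a bump, `∫ ψ² = r·N_k` (`N_k = ‖flatProfile k‖₂²`). [folklore] -/
theorem integral_bump_sq_eq_of_eq_flatLobe (hr : 0 < r) {ψ : ContDiffBump (0 : ℝ)}
    (hψ : (fun x : ℝ ↦ ((ψ x : ℝ) : ℂ)) = flatLobe k r 0) :
    ∫ y : ℝ, ψ y ^ 2 = r * weilNorm2Sq (flatProfile k) := by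
  rw [← integral_norm_sq_flatLobe (k := k) hr 0, ← hψ]
  congr 1 with y
  rw [Complex.norm_real, Real.norm_eq_abs, sq_abs]

/-! ## §2 The two-sided shadow with the flat-lobe allowance -/

/-- **The shadow, explicit.** For `0 < r ≤ 1/4`, `2r < L` and `WeilPositivityOn (L/2 + r)`, with `f = flatLobe k r 0`, `φ = f ⋆ f̃`:
`|Re Σ_n Λ(n)n^{−1/2}φ(log n − L) − (e^{L/2} + e^{−L/2})·Re φ̂(1)| ≤ (log(1/r) + C_k + 8r·M(L/2 − r))·r·N_k`,
`C_k = flatEnergyConst k`, `M = archGapBound`, `N_k = weilNorm2Sq (flatProfile k) ∈ [1, 2]`. [this track, ATTEMPT-11 §3] -/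
theorem abs_chebyshev_sub_main_le_flat (k : ℕ) (hr : 0 < r) (hr4 : r ≤ 1 / 4) (hL : 2 * r < L)
    (hW : WeilPositivityOn (L / 2 + r)) :
    |(∑' n : ℕ, ((Λ n : ℝ) : ℂ) / (Real.sqrt n : ℂ) *
            (weilConv (flatLobe k r 0) (weilReflect (flatLobe k r 0))) (Real.log n - L)).re -
        (Real.exp (L / 2) + Real.exp (-(L / 2))) *
          (weilMellin (weilConv (flatLobe k r 0) (weilReflect (flatLobe k r 0))) 1).re| ≤
      (Real.log (1 / r) + flatEnergyConst k + 8 * r * archGapBound (L / 2 - r)) *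
        (r * weilNorm2Sq (flatProfile k)) := by
  obtain ⟨ψ, hout, -, hψ⟩ := exists_bump_eq_flatLobe k hr
  have h := abs_chebyshev_sub_main_le ψ (L := L) (by rw [hout]; exact hL) (by rw [hout]; exact hW)
  rw [hout, integral_bump_sq_eq_of_eq_flatLobe hr hψ, hψ] at h
  have hQ := re_weilQuadratic_flatLobe_le (k := k) hr hr4 0
  rw [integral_norm_sq_flatLobe hr 0] at hQ
  have hN : 0 ≤ r * weilNorm2Sq (flatProfile k) := by
    have := one_le_weilNorm2Sq_flatProfile k
    positivity
  nlinarith [h, hQ, hN, archGapBound_pos (c' := L / 2 - r) (by linarith)]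

/-- `M(c′) ≤ 1.27` for `c′ ≥ 1/4` (`e^{1/4} ≥ 5/4`, `1 − e^{−1} ≥ 0.63`; `M` is antitone). [folklore] -/
theorem archGapBound_le {c' : ℝ} (hc' : 1 / 4 ≤ c') : archGapBound c' ≤ 1.27 := by
  unfold archGapBound
  have h1 : (5 / 4 : ℝ) ≤ Real.exp c' := by
    have := Real.add_one_le_exp (1 / 4 : ℝ)
    have := Real.exp_le_exp.2 hc'
    linarith
  have h2 : Real.exp (-(4 * c')) ≤ Real.exp (-1) := Real.exp_le_exp.2 (by linarith)
  have h3 : Real.exp (-1 : ℝ) ≤ 0.37 := by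
    rw [Real.exp_neg]
    have := Real.exp_one_gt_d9
    rw [inv_le_comm₀ (Real.exp_pos _) (by norm_num)]
    linarith
  have h4 : (0.63 : ℝ) ≤ 1 - Real.exp (-(4 * c')) := by linarith
  rw [div_le_iff₀ (by nlinarith [Real.exp_pos c'])]
  nlinarith

/-- **The shadow, with numbers.** For `0 < r ≤ 1/4`, `2r + 1/2 ≤ L` and `WeilPositivityOn (L/2 + r)`:
`|S_r(L) − M_r(L)| ≤ 2r·(log(1/r) + C_k + 3)` (`N_k ≤ 2`, `8r·M ≤ 8·¼·1.27 < 3`). [this track, ATTEMPT-11 §3] -/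
theorem abs_chebyshev_sub_main_le_flat' (k : ℕ) (hr : 0 < r) (hr4 : r ≤ 1 / 4) (hL : 2 * r + 1 / 2 ≤ L)
    (hW : WeilPositivityOn (L / 2 + r)) :
    |(∑' n : ℕ, ((Λ n : ℝ) : ℂ) / (Real.sqrt n : ℂ) *
            (weilConv (flatLobe k r 0) (weilReflect (flatLobe k r 0))) (Real.log n - L)).re -
        (Real.exp (L / 2) + Real.exp (-(L / 2))) *
          (weilMellin (weilConv (flatLobe k r 0) (weilReflect (flatLobe k r 0))) 1).re| ≤
      2 * r * (Real.log (1 / r) + flatEnergyConst k + 3) := by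
  have h := abs_chebyshev_sub_main_le_flat k hr hr4 (by linarith) hW
  have hM := archGapBound_le (c' := L / 2 - r) (by linarith)
  have hM0 := archGapBound_pos (c' := L / 2 - r) (by linarith)
  have hN2 := weilNorm2Sq_flatProfile_le_two k
  have hN1 := one_le_weilNorm2Sq_flatProfile k
  have hlog : 0 ≤ Real.log (1 / r) := Real.log_nonneg (by rw [le_div_iff₀ hr]; linarith)
  have hC := six_le_flatEnergyConst k
  have h8 : 8 * r * archGapBound (L / 2 - r) ≤ 3 := by nlinarith
  calc _ ≤ (Real.log (1 / r) + flatEnergyConst k + 8 * r * archGapBound (L / 2 - r)) *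
        (r * weilNorm2Sq (flatProfile k)) := h
    _ ≤ (Real.log (1 / r) + flatEnergyConst k + 3) * (r * 2) := by
        apply mul_le_mul (by linarith) (by nlinarith) (by positivity) (by positivity)
    _ = 2 * r * (Real.log (1 / r) + flatEnergyConst k + 3) := by ring

/-! ## §3 Unweighting (order `k = 0`, flat radius `r/2`): a Brun–Titchmarsh-type bound -/

/-- The autocorrelation of a bump with inner radius `r/2` is at least `r/2` at lags `|y| ≤ r/2`: on the interval
`[y/2 − r/4, y/2 + r/4]` both factors `ψ(u)`, `ψ(u − y)` equal `1`. [folklore] -/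
theorem half_le_autocorr {ψ : ContDiffBump (0 : ℝ)} (hin : ψ.rIn = r / 2) (hr : 0 < r) {y : ℝ} (hy : |y| ≤ r / 2) :
    r / 2 ≤ ∫ u : ℝ, ψ u * ψ (u - y) := by
  have hint : Integrable fun u : ℝ ↦ ψ u * ψ (u - y) :=
    (ψ.continuous.mul (ψ.continuous.comp (continuous_id.sub continuous_const))).integrable_of_hasCompactSupport
      (ψ.hasCompactSupport.mul_right)
  have hsub : ∫ u in Icc (y / 2 - r / 4) (y / 2 + r / 4), ψ u * ψ (u - y) ≤ ∫ u : ℝ, ψ u * ψ (u - y) :=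
    setIntegral_le_integral hint (Eventually.of_forall fun u ↦ mul_nonneg ψ.nonneg ψ.nonneg)
  have hone : ∀ u ∈ Icc (y / 2 - r / 4) (y / 2 + r / 4), ψ u * ψ (u - y) = 1 := by
    intro u hu
    have hy' := abs_le.1 hy
    have h1 : ψ u = 1 := by
      apply ψ.one_of_mem_closedBall
      rw [mem_closedBall, dist_zero_right, Real.norm_eq_abs, hin, abs_le]
      constructor <;> linarith [hu.1, hu.2]
    have h2 : ψ (u - y) = 1 := by
      apply ψ.one_of_mem_closedBall
      rw [mem_closedBall, dist_zero_right, Real.norm_eq_abs, hin, abs_le]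
      constructor <;> linarith [hu.1, hu.2]
    rw [h1, h2, mul_one]
  have hval : ∫ u in Icc (y / 2 - r / 4) (y / 2 + r / 4), ψ u * ψ (u - y) = r / 2 := by
    rw [setIntegral_congr_fun measurableSet_Icc hone, setIntegral_const, smul_eq_mul, mul_one,
      Real.volume_real_Icc_of_le (by linarith)]
    ring
  linarith

/-- Summability of the real smoothed sum (finitely many non-zero terms). [folklore] -/
theorem summable_F_terms (ψ : ContDiffBump (0 : ℝ)) (L : ℝ) :
    Summable fun n : ℕ ↦ (Λ n : ℝ) / Real.sqrt n * ∫ u : ℝ, ψ u * ψ (u - (Real.log n - Real.log (Real.exp L))) :=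
  summable_of_ne_finset_zero (s := Finset.range (⌊Real.exp (2 * ψ.rOut + |Real.log (Real.exp L)|)⌋₊ + 1)) fun n hn ↦ by
    rw [Finset.mem_range, not_lt] at hn
    rw [window_eq_zero ψ (lt_of_lt_of_le (Nat.lt_floor_add_one _) (by exact_mod_cast hn)), mul_zero]

/-- The window picks out the atoms near `e^{L}`: for a bump with `rIn = r/2` and any finite set `T` of integers with
`|log n − L| ≤ r/2`, `(r/2)·Σ_{n∈T} Λ(n)/√n ≤ S_ψ(L)`. [folklore] -/
theorem half_mul_sum_le_chebyshev {ψ : ContDiffBump (0 : ℝ)} (hin : ψ.rIn = r / 2) (hr : 0 < r) (T : Finset ℕ)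
    (hT : ∀ n ∈ T, |Real.log n - L| ≤ r / 2) :
    r / 2 * ∑ n ∈ T, (Λ n : ℝ) / Real.sqrt n ≤
      (∑' n : ℕ, ((Λ n : ℝ) : ℂ) / (Real.sqrt n : ℂ) *
          (weilConv (fun x : ℝ ↦ ((ψ x : ℝ) : ℂ)) (weilReflect fun x : ℝ ↦ ((ψ x : ℝ) : ℂ))) (Real.log n - L)).re := by
  rw [re_tsum_eq_F ψ L]
  simp only []
  have hsum := summable_F_terms ψ L
  have hnn : ∀ n : ℕ, 0 ≤ (Λ n : ℝ) / Real.sqrt n * ∫ u : ℝ, ψ u * ψ (u - (Real.log n - Real.log (Real.exp L))) :=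
    fun n ↦ mul_nonneg (div_nonneg ArithmeticFunction.vonMangoldt_nonneg (Real.sqrt_nonneg _)) (autocorr_nonneg ψ _)
  have h1 : ∑ n ∈ T, (Λ n : ℝ) / Real.sqrt n * ∫ u : ℝ, ψ u * ψ (u - (Real.log n - Real.log (Real.exp L))) ≤
      ∑' n : ℕ, (Λ n : ℝ) / Real.sqrt n * ∫ u : ℝ, ψ u * ψ (u - (Real.log n - Real.log (Real.exp L))) :=
    hsum.sum_le_tsum T fun n _ ↦ hnn n
  have h2 : r / 2 * ∑ n ∈ T, (Λ n : ℝ) / Real.sqrt n ≤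
      ∑ n ∈ T, (Λ n : ℝ) / Real.sqrt n * ∫ u : ℝ, ψ u * ψ (u - (Real.log n - Real.log (Real.exp L))) := by
    rw [Finset.mul_sum]
    refine Finset.sum_le_sum fun n hn ↦ ?_
    rw [Real.log_exp, mul_comm]
    exact mul_le_mul_of_nonneg_left (half_le_autocorr hin hr (hT n hn))
      (div_nonneg ArithmeticFunction.vonMangoldt_nonneg (Real.sqrt_nonneg _))
  exact h2.trans h1

/-- The flat lobe is even. [folklore] -/
theorem flatLobe_zero_neg (k : ℕ) (r x : ℝ) : flatLobe k r 0 (-x) = flatLobe k r 0 x := by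
  simp only [flatLobe, flatProfile, sub_zero, neg_div]
  rw [(flatBump k).neg]

/-- `f̂(0) = f̂(1)` for the (real, even) flat lobe at `0`. [folklore] -/
theorem weilMellin_flatLobe_zero_eq_one (k : ℕ) (r : ℝ) : weilMellin (flatLobe k r 0) 0 = weilMellin (flatLobe k r 0) 1 := by
  unfold weilMellin
  rw [← integral_neg_eq_self (fun t : ℝ ↦ flatLobe k r 0 t * cexp ((0 - 1 / 2) * (t : ℂ))) volume]
  congr 1 with t
  rw [flatLobe_zero_neg]
  congr 1
  push_cast
  ring_nf

/-- The main-term coefficient of the flat lobe is a square: `Re φ̂(1) = |f̂(1)|²` and hence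
`e^{−r}·r²·M_k² ≤ Re φ̂(1) ≤ 4r²e^{r}` (`r > 0`). [this track, ATTEMPT-11 §3] -/
theorem re_weilMellin_autocorr_flatLobe_one (k : ℕ) (hr : 0 < r) :
    (weilMellin (weilConv (flatLobe k r 0) (weilReflect (flatLobe k r 0))) 1).re =
        Complex.normSq (weilMellin (flatLobe k r 0) 1) := by
  have hf := isWeilTest_flatLobe (k := k) hr 0
  rw [weilMellin_weilConv_holds hf.1.continuous hf.2 hf.weilReflect.1.continuous hf.weilReflect.2,
    weilMellin_weilReflect_holds, show (1 : ℂ) - conj (1 : ℂ) = 0 by simp, weilMellin_flatLobe_zero_eq_one,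
    Complex.mul_conj, Complex.ofReal_re]

/-- Upper bound of the main-term coefficient: `Re φ̂(1) ≤ 4r²·e^{r}`. [folklore] -/
theorem re_weilMellin_autocorr_flatLobe_one_le (k : ℕ) (hr : 0 < r) :
    (weilMellin (weilConv (flatLobe k r 0) (weilReflect (flatLobe k r 0))) 1).re ≤ 4 * r ^ 2 * Real.exp r := by
  rw [re_weilMellin_autocorr_flatLobe_one k hr, Complex.normSq_eq_norm_sq]
  have h := norm_weilMellin_flatLobe_zero_le (k := k) hr (1 : ℂ)
  simp only [Complex.one_re] at h
  rw [show |(1 : ℝ) - 1 / 2| = 1 / 2 by norm_num] at h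
  have h0 : 0 ≤ ‖weilMellin (flatLobe k r 0) 1‖ := norm_nonneg _
  have hsq : ‖weilMellin (flatLobe k r 0) 1‖ ^ 2 ≤ (2 * r * Real.exp (r * (1 / 2))) ^ 2 := pow_le_pow_left₀ h0 h 2
  have he : Real.exp (r * (1 / 2)) ^ 2 = Real.exp r := by rw [sq, ← Real.exp_add]; ring_nf
  nlinarith [hsq, he]

/-- Lower bound of the main-term coefficient: `e^{−r}·r²·M_k² ≤ Re φ̂(1)`. [folklore] -/
theorem le_re_weilMellin_autocorr_flatLobe_one (k : ℕ) (hr : 0 < r) :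
    Real.exp (-r) * r ^ 2 * flatMass k ^ 2 ≤ (weilMellin (weilConv (flatLobe k r 0) (weilReflect (flatLobe k r 0))) 1).re := by
  rw [re_weilMellin_autocorr_flatLobe_one k hr]
  have h := normSq_weilMellin_flatLobe_one_ge (k := k) hr 0
  rwa [zero_sub] at h

/-- **Brun–Titchmarsh from a window (crude unweighting).** For `0 < r ≤ 1/4`, `2r + 1/2 ≤ L`, `WeilPositivityOn (L/2 + r)`, and
any finite set `T` of integers with `|log n − L| ≤ r/2` (i.e. `n ∈ [x e^{−r/2}, x e^{r/2}]`, `x = e^{L}`):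
`Σ_{n∈T} Λ(n)/√n ≤ 8r·e^{r}·(e^{L/2} + e^{−L/2}) + 4·(log(1/r) + C₀ + 3)`. The main term is `8×` the expected `≈ r·e^{L/2}`
(the weighted statement `abs_chebyshev_sub_main_le_flat'` has the exact coefficient); the fluctuation term is `√x·log(x/h)`-sized in
`Λ`-units. [this track, ATTEMPT-11 §3] -/
theorem sum_vonMangoldt_window_le (hr : 0 < r) (hr4 : r ≤ 1 / 4) (hL : 2 * r + 1 / 2 ≤ L) (hW : WeilPositivityOn (L / 2 + r))
    (T : Finset ℕ) (hT : ∀ n ∈ T, |Real.log n - L| ≤ r / 2) :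
    ∑ n ∈ T, (Λ n : ℝ) / Real.sqrt n ≤
      8 * r * Real.exp r * (Real.exp (L / 2) + Real.exp (-(L / 2))) + 4 * (Real.log (1 / r) + flatEnergyConst 0 + 3) := by
  obtain ⟨ψ, hout, hin, hψ⟩ := exists_bump_eq_flatLobe 0 hr
  have hin' : ψ.rIn = r / 2 := by rw [hin, flatBump_rIn]; norm_num; ring
  have hS := half_mul_sum_le_chebyshev (L := L) hin' hr T hT
  rw [hψ] at hS
  have h := abs_chebyshev_sub_main_le_flat' 0 hr hr4 hL hW
  have hM := re_weilMellin_autocorr_flatLobe_one_le 0 hr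
  have hlow := (abs_le.1 h).2
  have hcosh : 0 ≤ Real.exp (L / 2) + Real.exp (-(L / 2)) := by positivity
  have hkey : r / 2 * ∑ n ∈ T, (Λ n : ℝ) / Real.sqrt n ≤
      (Real.exp (L / 2) + Real.exp (-(L / 2))) * (4 * r ^ 2 * Real.exp r) +
        2 * r * (Real.log (1 / r) + flatEnergyConst 0 + 3) := by
    nlinarith [hS, hlow, mul_le_mul_of_nonneg_left hM hcosh]
  have hr2 : 0 < r / 2 := by positivity
  rw [← sub_nonneg] at hkey ⊢
  have : 0 ≤ (2 / r) * ((Real.exp (L / 2) + Real.exp (-(L / 2))) * (4 * r ^ 2 * Real.exp r) +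
      2 * r * (Real.log (1 / r) + flatEnergyConst 0 + 3) - r / 2 * ∑ n ∈ T, (Λ n : ℝ) / Real.sqrt n) :=
    mul_nonneg (by positivity) hkey
  have hr0 : r ≠ 0 := hr.ne'
  calc (0 : ℝ) ≤ _ := this
    _ = _ := by field_simp; ring

/-! ## §4 The lower half on a prime-power-free stretch: Cramér's bound for every gap below the window -/

/-- On a prime-power-free multiplicative stretch the smoothed sum VANISHES: if `Λ(n) = 0` whenever `|log n − L| ≤ 2r` then
`S_r(L) = 0` (the kernel `φ` is supported in `[−2r, 2r]`). [folklore] -/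
theorem chebyshev_eq_zero_of_primePowerFree (k : ℕ) (hr : 0 < r)
    (hfree : ∀ n : ℕ, |Real.log n - L| ≤ 2 * r → Λ n = 0) :
    (∑' n : ℕ, ((Λ n : ℝ) : ℂ) / (Real.sqrt n : ℂ) *
        (weilConv (flatLobe k r 0) (weilReflect (flatLobe k r 0))) (Real.log n - L)).re = 0 := by
  obtain ⟨ψ, hout, -, hψ⟩ := exists_bump_eq_flatLobe k hr
  rw [← hψ]
  have hzero : ∀ n : ℕ, ((Λ n : ℝ) : ℂ) / (Real.sqrt n : ℂ) *
      (weilConv (fun x : ℝ ↦ ((ψ x : ℝ) : ℂ)) (weilReflect fun x : ℝ ↦ ((ψ x : ℝ) : ℂ))) (Real.log n - L) = 0 := by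
    intro n
    rcases le_or_gt |Real.log n - L| (2 * r) with h | h
    · rw [hfree n h]; simp
    · rw [autocorr_eq_zero ψ (by rw [hout]; exact h), mul_zero]
  simp [hzero]

/-- **Cramér's bound for every prime-power-free stretch below the window.** For `0 < r ≤ 1/4`, `2r + 1/2 ≤ L`,
`WeilPositivityOn (L/2 + r)`: if no prime power `n` satisfies `|log n − L| ≤ 2r` (the stretch `[x e^{−2r}, x e^{2r}]`, `x = e^{L}`, is
free of prime powers), then `(e^{L/2} + e^{−L/2})·e^{−r}·r²·M_k² ≤ 2r·(log(1/r) + C_k + 3)` — so `r√x ≤ 2e^{r}(log(1/r) + C_k + 3)/M_k²`,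
i.e. the stretch has length `≈ 4rx ≲ (8e^{r}/M_k²)·√x·(log(1/r) + C_k + 3)`, `M_k² → 4`: `≲ (1 + o(1))√x log x`.
[this track, ATTEMPT-11 §3 (cf. gen3 `edgeNonnegOdd_sharp_classification`, the case of the window's own gap)] -/
theorem mul_exp_le_of_primePowerFree (k : ℕ) (hr : 0 < r) (hr4 : r ≤ 1 / 4) (hL : 2 * r + 1 / 2 ≤ L)
    (hW : WeilPositivityOn (L / 2 + r)) (hfree : ∀ n : ℕ, |Real.log n - L| ≤ 2 * r → Λ n = 0) :
    (Real.exp (L / 2) + Real.exp (-(L / 2))) * (Real.exp (-r) * r ^ 2 * flatMass k ^ 2) ≤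
      2 * r * (Real.log (1 / r) + flatEnergyConst k + 3) := by
  have h := abs_chebyshev_sub_main_le_flat' k hr hr4 hL hW
  rw [chebyshev_eq_zero_of_primePowerFree k hr hfree, zero_sub, abs_neg] at h
  have hm := le_re_weilMellin_autocorr_flatLobe_one k hr
  have hcosh : 0 ≤ Real.exp (L / 2) + Real.exp (-(L / 2)) := by positivity
  calc _ ≤ (Real.exp (L / 2) + Real.exp (-(L / 2))) *
        (weilMellin (weilConv (flatLobe k r 0) (weilReflect (flatLobe k r 0))) 1).re :=
        mul_le_mul_of_nonneg_left hm hcosh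
    _ ≤ |(Real.exp (L / 2) + Real.exp (-(L / 2))) *
        (weilMellin (weilConv (flatLobe k r 0) (weilReflect (flatLobe k r 0))) 1).re| := le_abs_self _
    _ ≤ _ := h

end Summit.RiemannHypothesis.RiemannHypothesis.Theorems.HandoffPrimeShadow

end
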